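import Summits.Ventures.CertifiedArithmetic.LowPrec.DoubleRoundingFMAWindows
import Summits.Ventures.CertifiedArithmetic.LowPrec.DoubleRoundingFMAWindowB
import Summits.Ventures.CertifiedArithmetic.LowPrec.DoubleRoundingFMANearWideWitness
import Summits.Ventures.CertifiedArithmetic.LowPrec.DoubleRoundingFMAEqualPrecision

/-!
# The middle columns decided: the window-B threshold is exact (THEOREM D-fma-M, all records)

HONEST FRAMING: certified error envelopes and provably optimal rounding/accumulation schemes for
low-precision formats under stated cost models; every table by two implementations; no hardware
or vendor claims.

On the columns `2 P_φ ≤ P_ψ ≤ 3 P_φ - 2` (`m + 1 ≤ n := m_ψ - m ≤ 2m`, `m = m_φ`) the window clause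
(F) of THEOREM D-fma (`dFma_of_windows`, closed form `dFma_of_windows_le`) proves `DFma φ ψ` when
`maxRat φ ≤ W := 2^(P_ψ + 2 L_φ)`, i.e. `M_φ ≤ 2^(m_ψ + 2 - m - bias φ)` quanta (WINDOW B MOOT), and
THEOREM N-fma-B (`DoubleRoundingFMAWindowB.lean`) refutes it from `(1 + 2^-m)·W` (tie column,
`n` even) resp. `2(1 + 2^-m)·W` (`n` odd) on.  THEOREM D-fma-M closes the gap: under the grid
conditions of (F) — `F_φ ⊆ F_ψ`, `P_ψ ≥ 2 P_φ`, `bias φ ≤ bias ψ`, `L_ψ ≤ 2 L_φ`, `L_ψ + P_ψ ≤ L_φ` —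
with `m ≥ 1`, `bias φ ≥ 1` and `bias φ + 2m ≤ m_ψ + 1` (the first branch of the range hypothesis
hR of `DoubleRoundingFMAWideIff.lean`: `W` is at least twice the smallest normal value of `φ`),

  `fmaMidPairTest m n  →  (DFma φ ψ ↔ M_φ ≤ 2^(m_ψ + 2 - m - bias φ))`   (`dFma_middle_iff`),

where `fmaMidPairTest m n` — a property of the two precisions alone — says that `2^n - 1`, or
`K·2^n + 1` for some `1 ≤ K < 2^(2m+2-n)`, is a product `a₁·b₁` of two numbers below `2^P_φ`.
THE WITNESS (`not_dFma_of_fmaMidPairTest`), with `h = 2^k` quanta, `k = n + 1 - m - bias φ`, the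
half-spacing of `φ` at `W = 2^(m+1)·h`: the first midpoint `μ = W + h` of window B is hit from
above by ONE square quantum, `a·b + c = μ + quantum²` — a TIE of `ψ` (`½ ulp_ψ(μ) = quantum²`)
resolved onto `μ`, which is even in `ψ` as `n ≥ 2` [BoldoMelquiond2008, Thm 3]; `fl_φ μ = W` (even
side) while `fl_φ(a·b + c) = W + 2h` (`roundNE_roundNE_ne_gmid_tie` with `t = 2^m`): either
`a = -a₁`, `b = b₁` quanta and `c = W + 2h` (`a₁ b₁ = 2^n - 1`), or `a = a₁`, `b = b₁` quanta and
`c = (2^(m+1) + 1 - K)·h ≤ W` (`a₁ b₁ = K·2^n + 1`); it needs exactly `W + 2h ≤ maxRat φ`, i.e.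
`M_φ > W`.  For EVEN `n` the pair `(2^(n/2) - 1)(2^(n/2) + 1) = 2^n - 1` is THEOREM N-fma-B's tie
witness (so there the news is only the boundary `M_φ = W`); for ODD `n` the threshold drops from
N-fma-B's `2(1 + 2^-m)·W` to `W` itself.  `fmaMidPairTest m n` holds for EVERY `1 ≤ m ≤ 11` and
`m + 1 ≤ n ≤ 2m` (`fmaMidPair_table`, `decide`; implementation A: `m ≤ 16`) and FAILS FIRST at
`(m, n) = (12, 23)` (`fmaMidPair_12_23`: `2^23 - 1 = 47·178481` and no `K·2^23 + 1`, `K < 8`,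
splits; implementation A exhibits a slip one square quantum BELOW the SECOND midpoint `W + 3h`,
`6563·7669 = 6·2^23 - 1`, so `DFma` fails from `M_φ = W + 4h` on and only `M_φ = W + 2h` is left
undecided there), then at `(16, 31)`.  At `n = 2m + 1` the test is the factor condition `F(P)` of
THEOREM D-fma-W′ (`2^(2P-1) ∓ 1`), consistently; for `n ≥ 2m + 2` it is empty.  NAMED CELLS
(`dFmaMiddle_named`, `dFmaMiddle_cells`): the hypotheses hold on `5` of the `169` cells —
e2m1 → e4m3 / binary8p4 / binary8p4f (`n = 2`, `W = 8 < M = 12` quanta: fail), e2m3 → bfloat16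
(`n = 4`, `32 < 60`: fail), e2m1 → binary8p5 (`n = 3 = 2m+1`, `9 = 3·3`, `M = 12 ≤ W = 16`: holds) —
re-deriving `dFmaPairs`; the odd-column phenomenon lives on unnamed registers (`P_ψ = 9` for FP6
e2m3, …).  PLACEMENT: innocuous double rounding thresholds for `+ - × ÷ √` [Figueroa1995] §3,
[Roux2014] §2; FMA emulation by rounding to odd [BoldoMelquiond2008] Thm 3; we found no
record-level range threshold for the FMA through a `2P … 3P-2`-digit register in the literature
searched (queries in the cell's notes).  Implementation A: `code/enum/fma_middle_law.py` →
`DOUBLE-ROUNDING-FMA.md` §13, `certs/enum/DOUBLE-ROUNDING-FMA-MIDDLE.json`.  No hardware or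
vendor claims.
-/

namespace Summit.Ventures.CertifiedArithmetic

open Literature.ComputerArithmetic.FloatingPoint
open Literature.ComputerArithmetic.FloatingPoint.Format
open Literature.ComputerArithmetic.FloatingPoint.MiniFloat

/-! ## §1 The test -/

/-- `fmaMidPairTest m n`: `2^n - 1`, or `K·2^n + 1` for some `1 ≤ K < 2^(2m+2-n)`, is a product
`a₁·b₁` with `0 < a₁ < 2^(m+1)`, `b₁ < 2^(m+1)` (`twoSigTest`).  The first midpoint of window B
of an `(m+1)`-digit source through an `(m+n+1)`-digit register is then a slip point. [this packet] -/
def fmaMidPairTest (m n : ℕ) : Bool :=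
  twoSigTest (m + 1) (2 ^ n - 1) ||
    (List.range (2 ^ (2 * m + 2 - n))).any fun K => decide (1 ≤ K) && twoSigTest (m + 1) (K * 2 ^ n + 1)

/-! ## §2 The witness -/

/-- A multiple `s·2^j ≤ maxScaled` with `s ≤ 2^(m+1)` is representable (`s = 2^(m+1)` included:
`2^m·2^(j+1)`). [folklore] -/
theorem representable_mul_pow_of_le {φ : Format} {s j : ℕ} (hs : s ≤ 2 ^ (φ.manBits + 1))
    (hle : s * 2 ^ j ≤ φ.maxScaled) : φ.Representable (s * 2 ^ j) := by
  rcases Nat.lt_or_ge s (2 ^ (φ.manBits + 1)) with h | h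
  · exact representable_mul_pow h hle
  · have hs' : s = 2 ^ (φ.manBits + 1) := le_antisymm hs h
    have e : s * 2 ^ j = 2 ^ φ.manBits * 2 ^ (j + 1) := by rw [hs', pow_succ, pow_succ]; ring
    rw [e] at hle ⊢
    exact representable_mul_pow (Nat.pow_lt_pow_right (by norm_num) (by omega)) hle

/-- THE MIDDLE DATA, family above: `a = -a₁`, `b = b₁` quanta with `a₁·b₁ = 2^n - 1` and
`c = (2^m + 1)·2^(k+1)` quanta, `k + m + bias = n + 1`: `a·b + c = (2·2^m + 1)·2^k·quantum +
quantum²`. [this packet] -/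
theorem exists_mid_data_above {φ : Format} (h1 : 1 ≤ φ.manBits) (hb : 1 ≤ φ.bias)
    {n k a₁ b₁ : ℕ}
    (hk : k + (φ.manBits + φ.bias) = n + 1) (hab : a₁ * b₁ + 1 = 2 ^ n)
    (ha₁ : a₁ < 2 ^ (φ.manBits + 1)) (hb₁ : b₁ < 2 ^ (φ.manBits + 1))
    (hu : (2 ^ φ.manBits + 1) * 2 ^ (k + 1) ≤ φ.maxScaled) :
    ∃ a b c : MiniFloat φ, a.toRat * b.toRat + c.toRat =
      (((2 * 2 ^ φ.manBits + 1) * 2 ^ k : ℕ) : ℚ) * φ.quantum + φ.quantum * φ.quantum := by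
  have hkey : (2 : ℚ) ^ n * φ.quantum = 2 ^ k := by
    rw [show n = k + (φ.manBits + (φ.bias - 1)) by omega, pow_add, mul_assoc,
      two_pow_mul_quantum_eq_one hb, mul_one]
  have hsmall : 2 ^ (φ.manBits + 1) ≤ φ.maxScaled := by
    refine le_trans ?_ hu
    calc 2 ^ (φ.manBits + 1) = 2 ^ φ.manBits * 2 ^ 1 := by rw [pow_succ, pow_one]
      _ ≤ (2 ^ φ.manBits + 1) * 2 ^ (k + 1) :=
        Nat.mul_le_mul (Nat.le_succ _) (Nat.pow_le_pow_right (by norm_num) (by omega))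
  obtain ⟨a, ha⟩ := exists_toRat_eq_natMul (representable_of_lt_pow ha₁ (by omega))
  obtain ⟨b, hb2⟩ := exists_toRat_eq_natMul (representable_of_lt_pow hb₁ (by omega))
  have hclt : 2 ^ φ.manBits + 1 < 2 ^ (φ.manBits + 1) := by
    have : 2 ^ 1 ≤ 2 ^ φ.manBits := Nat.pow_le_pow_right (by norm_num) h1
    rw [pow_one] at this; rw [pow_succ]; omega
  obtain ⟨c, hc⟩ := exists_toRat_eq_natMul (representable_mul_pow hclt hu)
  have habQ : (a₁ : ℚ) * b₁ + 1 = 2 ^ n := by exact_mod_cast hab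
  refine ⟨a.flipSign, b, c, ?_⟩
  rw [toRat_flipSign, ha, hb2, hc]
  push_cast
  linear_combination (-(φ.quantum * φ.quantum)) * habQ + (-φ.quantum) * hkey

/-- THE MIDDLE DATA, family below: `a = a₁`, `b = b₁` quanta with `a₁·b₁ = K·2^n + 1`,
`1 ≤ K ≤ 2^(m+1)`, and `c = (2^(m+1) + 1 - K)·2^k` quanta (at or below `W = 2^(m+1+k)`):
`a·b + c = (2·2^m + 1)·2^k·quantum + quantum²`. [this packet] -/
theorem exists_mid_data_below {φ : Format} (hb : 1 ≤ φ.bias) {n k a₁ b₁ K : ℕ}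
    (hk : k + (φ.manBits + φ.bias) = n + 1) (hab : a₁ * b₁ = K * 2 ^ n + 1) (hK1 : 1 ≤ K)
    (hK : K ≤ 2 ^ (φ.manBits + 1))
    (ha₁ : a₁ < 2 ^ (φ.manBits + 1)) (hb₁ : b₁ < 2 ^ (φ.manBits + 1))
    (hu : (2 ^ φ.manBits + 1) * 2 ^ (k + 1) ≤ φ.maxScaled) :
    ∃ a b c : MiniFloat φ, a.toRat * b.toRat + c.toRat =
      (((2 * 2 ^ φ.manBits + 1) * 2 ^ k : ℕ) : ℚ) * φ.quantum + φ.quantum * φ.quantum := by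
  have hkey : (2 : ℚ) ^ n * φ.quantum = 2 ^ k := by
    rw [show n = k + (φ.manBits + (φ.bias - 1)) by omega, pow_add, mul_assoc,
      two_pow_mul_quantum_eq_one hb, mul_one]
  have hsmall : 2 ^ (φ.manBits + 1) ≤ φ.maxScaled := by
    refine le_trans ?_ hu
    calc 2 ^ (φ.manBits + 1) = 2 ^ φ.manBits * 2 ^ 1 := by rw [pow_succ, pow_one]
      _ ≤ (2 ^ φ.manBits + 1) * 2 ^ (k + 1) :=
        Nat.mul_le_mul (Nat.le_succ _) (Nat.pow_le_pow_right (by norm_num) (by omega))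
  obtain ⟨a, ha⟩ := exists_toRat_eq_natMul (representable_of_lt_pow ha₁ (by omega))
  obtain ⟨b, hb2⟩ := exists_toRat_eq_natMul (representable_of_lt_pow hb₁ (by omega))
  obtain ⟨s, hs⟩ : ∃ s, s + K = 2 ^ (φ.manBits + 1) + 1 := ⟨2 ^ (φ.manBits + 1) + 1 - K, by omega⟩
  have hsle : s ≤ 2 ^ (φ.manBits + 1) := by omega
  have hsu : s * 2 ^ k ≤ φ.maxScaled := by
    refine le_trans ?_ hu
    calc s * 2 ^ k ≤ 2 ^ (φ.manBits + 1) * 2 ^ k := Nat.mul_le_mul_right _ hsle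
      _ = 2 ^ φ.manBits * 2 ^ (k + 1) := by rw [pow_succ, pow_succ]; ring
      _ ≤ (2 ^ φ.manBits + 1) * 2 ^ (k + 1) := Nat.mul_le_mul_right _ (Nat.le_succ _)
  obtain ⟨c, hc⟩ := exists_toRat_eq_natMul (representable_mul_pow_of_le hsle hsu)
  have habQ : (a₁ : ℚ) * b₁ = K * 2 ^ n + 1 := by exact_mod_cast hab
  have hsQ : (s : ℚ) + K = 2 ^ (φ.manBits + 1) + 1 := by exact_mod_cast hs
  refine ⟨a, b, c, ?_⟩
  rw [ha, hb2, hc]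
  push_cast
  linear_combination (φ.quantum * φ.quantum) * habQ + (2 ^ k * φ.quantum) * hsQ
    + (K * φ.quantum) * hkey

/-- THE SLIP at the first midpoint of window B: with `m_ψ = m + n`, `k + m + bias = n + 1`,
`m_ψ ≤ m + k + D` and the upper neighbour `(2^m + 1)·2^(k+1)` in range, data with
`a·b + c = (2·2^m + 1)·2^k·quantum + quantum²` refute `DFma φ ψ` — the sum is the tie of `ψ`
above the midpoint, resolved onto it (`roundNE_roundNE_ne_gmid_tie`, `t = 2^m`).
[cite: BoldoMelquiond2008, Thm 3] -/
theorem not_dFma_of_mid_sum {φ ψ : Format} (hq : ψ.qexp ≤ φ.qexp)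
    (hM : φ.maxScaled * 2 ^ (φ.qexp - ψ.qexp).toNat ≤ ψ.maxScaled) (h1 : 1 ≤ φ.manBits)
    (hb : 1 ≤ φ.bias) {n k : ℕ} (hn : ψ.manBits = φ.manBits + n) (hn2 : 2 ≤ n)
    (hk : k + (φ.manBits + φ.bias) = n + 1)
    (hk' : ψ.manBits ≤ φ.manBits + k + (φ.qexp - ψ.qexp).toNat)
    (hu : (2 ^ φ.manBits + 1) * 2 ^ (k + 1) ≤ φ.maxScaled) {a b c : MiniFloat φ}
    (habc : a.toRat * b.toRat + c.toRat =
      (((2 * 2 ^ φ.manBits + 1) * 2 ^ k : ℕ) : ℚ) * φ.quantum + φ.quantum * φ.quantum) :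
    ¬ DFma φ ψ := by
  set d := (φ.qexp - ψ.qexp).toNat with hd
  have hqψ := ψ.quantum_pos
  have hquant : φ.quantum = 2 ^ d * ψ.quantum := quantum_eq_two_pow_mul hq
  have hkey : (2 : ℚ) ^ n * φ.quantum = 2 ^ k := by
    rw [show n = k + (φ.manBits + (φ.bias - 1)) by omega, pow_add, mul_assoc,
      two_pow_mul_quantum_eq_one hb, mul_one]
  have hδψ : 2 * (φ.quantum * φ.quantum)
      = 2 ^ (φ.manBits + k + d + 1 - ψ.manBits) * ψ.quantum := by
    have H : (2 : ℚ) ^ n * (2 * (φ.quantum * φ.quantum))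
        = 2 ^ n * (2 ^ (φ.manBits + k + d + 1 - ψ.manBits) * ψ.quantum) := by
      calc (2 : ℚ) ^ n * (2 * (φ.quantum * φ.quantum))
          = 2 * (2 ^ n * φ.quantum) * φ.quantum := by ring
        _ = 2 ^ (k + d + 1) * ψ.quantum := by rw [hkey, hquant, pow_add, pow_succ]; ring
        _ = 2 ^ (n + (φ.manBits + k + d + 1 - ψ.manBits)) * ψ.quantum := by
            rw [show n + (φ.manBits + k + d + 1 - ψ.manBits) = k + d + 1 by omega]
        _ = 2 ^ n * (2 ^ (φ.manBits + k + d + 1 - ψ.manBits) * ψ.quantum) := by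
            rw [pow_add]; ring
    exact mul_left_cancel₀ (by positivity) H
  have ht : Even (2 ^ φ.manBits) := Nat.even_pow.mpr ⟨even_two, by omega⟩
  have hthi : 2 ^ φ.manBits < 2 ^ (φ.manBits + 1) := Nat.pow_lt_pow_right (by norm_num) (by omega)
  intro hD
  have h' := hD a b c
  rw [habc] at h'
  exact roundNE_roundNE_ne_gmid_tie hq hM h1 (by omega) ht le_rfl hthi hu hk' hδψ h'

/-- THEOREM D-fma-M, the refutation: grids nested (`embedsTest`), `P_ψ ≥ 2 P_φ`, `L_ψ ≤ 2 L_φ`,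
`m ≥ 1`, `bias φ ≥ 1`, `bias φ + 2m ≤ m_ψ + 1`, `fmaMidPairTest m (m_ψ - m)` and a source reaching past
`W`: `2^(m_ψ + 2 - m - bias φ) < M_φ` ⟹ `¬ DFma φ ψ`. [this packet] -/
theorem not_dFma_of_fmaMidPairTest {φ ψ : Format} (hE : embedsTest φ ψ = true)
    (hm : 2 * φ.manBits + 1 ≤ ψ.manBits) (hq2 : ψ.qexp ≤ 2 * φ.qexp) (h1 : 1 ≤ φ.manBits)
    (hb : 1 ≤ φ.bias)
    (hreg : φ.bias + 2 * φ.manBits ≤ ψ.manBits + 1)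
    (hT : fmaMidPairTest φ.manBits (ψ.manBits - φ.manBits) = true)
    (hW : 2 ^ (ψ.manBits + 2 - φ.manBits - φ.bias) < φ.maxScaled) : ¬ DFma φ ψ := by
  have hE' := hE
  simp only [embedsTest, Bool.and_eq_true, decide_eq_true_eq] at hE'
  obtain ⟨⟨-, hq⟩, hM⟩ := hE'
  obtain ⟨n, hn⟩ : ∃ n, ψ.manBits = φ.manBits + n := ⟨ψ.manBits - φ.manBits, by omega⟩
  obtain ⟨k, hk⟩ : ∃ k, k + (φ.manBits + φ.bias) = n + 1 := ⟨n + 1 - (φ.manBits + φ.bias), by omega⟩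
  rw [show ψ.manBits - φ.manBits = n by omega] at hT
  rw [show ψ.manBits + 2 - φ.manBits - φ.bias = φ.manBits + (k + 1) by omega, pow_add] at hW
  -- the upper neighbour of `W` is finite
  have hu : (2 ^ φ.manBits + 1) * 2 ^ (k + 1) ≤ φ.maxScaled :=
    le_of_representable_gt_full le_rfl (representable_maxScaled φ) hW
  -- the grid of `ψ` is fine enough at the midpoint: `m_ψ ≤ m + k + D`
  set d := (φ.qexp - ψ.qexp).toNat with hd
  have hd0 : ((d : ℕ) : ℤ) = φ.qexp - ψ.qexp := Int.toNat_of_nonneg (by omega)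
  have hk' : ψ.manBits ≤ φ.manBits + k + d := by
    have : (φ.manBits : ℤ) + φ.bias - 1 ≤ d := by unfold Format.qexp at hd0 hq2; omega
    omega
  -- the two families of the test (`n ≥ m + 1 ≥ 2`)
  unfold fmaMidPairTest at hT
  rw [Bool.or_eq_true] at hT
  rcases hT with hT | hT
  · obtain ⟨a₁, b₁, ha0, ha₁, hb₁, hab⟩ := exists_mul_of_twoSigTest hT
    have hab' : a₁ * b₁ + 1 = 2 ^ n := by have := Nat.one_le_two_pow (n := n); omega
    have hn2 : 2 ≤ n := by omega
    obtain ⟨a, b, c, habc⟩ := exists_mid_data_above h1 hb hk hab' ha₁ hb₁ hu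
    exact not_dFma_of_mid_sum hq hM h1 hb hn hn2 hk hk' hu habc
  · obtain ⟨K, hKm, hK⟩ := List.any_eq_true.mp hT
    rw [List.mem_range] at hKm
    simp only [Bool.and_eq_true, decide_eq_true_eq] at hK
    obtain ⟨hK1, hK⟩ := hK
    obtain ⟨a₁, b₁, ha0, ha₁, hb₁, hab⟩ := exists_mul_of_twoSigTest hK
    have hn2 : 2 ≤ n := by omega
    have hKle : K ≤ 2 ^ (φ.manBits + 1) := by
      have h2 : 2 ^ (2 * φ.manBits + 2 - n) ≤ 2 ^ (φ.manBits + 1) :=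
        Nat.pow_le_pow_right (by norm_num) (by omega)
      omega
    obtain ⟨a, b, c, habc⟩ := exists_mid_data_below hb hk hab.symm hK1 hKle ha₁ hb₁ hu
    exact not_dFma_of_mid_sum hq hM h1 hb hn hn2 hk hk' hu habc

/-! ## §3 The criterion -/

/-- THEOREM D-fma-M, the positive half (closed window clause): under the grid conditions of (F)
with `m + bias φ ≤ m_ψ + 2` and `m ≥ 1`, `M_φ ≤ 2^(m_ψ + 2 - m - bias φ)` quanta (i.e.
`maxRat φ ≤ 2^(P_ψ + 2 L_φ)`; window A is then empty too) gives `DFma φ ψ`. [this packet] -/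
theorem dFma_of_le_windowB {φ ψ : Format} (hE : embedsTest φ ψ = true)
    (hm : 2 * φ.manBits + 1 ≤ ψ.manBits) (hbias : φ.bias ≤ ψ.bias) (hq2 : ψ.qexp ≤ 2 * φ.qexp)
    (hnorm : ψ.qexp + ψ.manBits + 1 ≤ φ.qexp) (h1 : 1 ≤ φ.manBits)
    (hmb : φ.manBits + φ.bias ≤ ψ.manBits + 2)
    (hW : φ.maxScaled ≤ 2 ^ (ψ.manBits + 2 - φ.manBits - φ.bias)) : DFma φ ψ := by
  obtain ⟨E, hEd⟩ : ∃ E, E + (φ.manBits + φ.bias) = ψ.manBits + 2 :=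
    ⟨ψ.manBits + 2 - φ.manBits - φ.bias, by omega⟩
  rw [show ψ.manBits + 2 - φ.manBits - φ.bias = E by omega] at hW
  have hwinA : φ.maxScaled ≤ 2 ^ (ψ.manBits + 1) :=
    hW.trans (Nat.pow_le_pow_right (by norm_num) (by omega))
  have hWq : ((2 ^ E : ℕ) : ℚ) * φ.quantum = (2 : ℚ) ^ ((ψ.manBits : ℤ) + 1 + 2 * φ.qexp) := by
    unfold Format.quantum Format.qexp
    push_cast
    rw [← zpow_natCast, ← zpow_add₀ (by norm_num : (2 : ℚ) ≠ 0)]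
    congr 1
    omega
  have hwinB : 3 * (φ.manBits + 1) ≤ ψ.manBits + 1 ∨
      φ.maxRat ≤ (2 : ℚ) ^ ((ψ.manBits : ℤ) + 1 + 2 * φ.qexp) := by
    right
    rw [← hWq]
    unfold Format.maxRat
    exact mul_le_mul_of_nonneg_right (by exact_mod_cast hW) φ.quantum_pos.le
  exact dFma_of_windows_le hE hm hbias hq2 hnorm hwinA hwinB

/-- THEOREM D-fma-M (every pair of format records).  Under `F_φ ⊆ F_ψ`, `P_ψ ≥ 2 P_φ`,
`bias φ ≤ bias ψ`, `L_ψ ≤ 2 L_φ`, `L_ψ + P_ψ ≤ L_φ`, `m ≥ 1`, `bias φ ≥ 1`, `bias φ + 2m ≤ m_ψ + 1`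
and `fmaMidPairTest m (m_ψ - m)`:  `DFma φ ψ ↔ M_φ ≤ 2^(m_ψ + 2 - m - bias φ)` — one fused
multiply-add of `φ`-data in `ψ`, converted to `φ`, is correctly rounded for ALL data iff the
largest finite value of `φ` does not exceed the left end `2^(P_ψ + 2 L_φ)` of window B.  On the
middle columns `2 P_φ ≤ P_ψ ≤ 3 P_φ - 2` the test holds for every `P_φ ≤ 12`
(`fmaMidPair_table`).  Implementation A = `code/enum/fma_middle_law.py`. [this packet] -/
theorem dFma_middle_iff {φ ψ : Format} (hE : embedsTest φ ψ = true)
    (hm : 2 * φ.manBits + 1 ≤ ψ.manBits) (hbias : φ.bias ≤ ψ.bias) (hq2 : ψ.qexp ≤ 2 * φ.qexp)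
    (hnorm : ψ.qexp + ψ.manBits + 1 ≤ φ.qexp) (h1 : 1 ≤ φ.manBits) (hb : 1 ≤ φ.bias)
    (hreg : φ.bias + 2 * φ.manBits ≤ ψ.manBits + 1)
    (hT : fmaMidPairTest φ.manBits (ψ.manBits - φ.manBits) = true) :
    DFma φ ψ ↔ φ.maxScaled ≤ 2 ^ (ψ.manBits + 2 - φ.manBits - φ.bias) := by
  refine ⟨fun hD => ?_, dFma_of_le_windowB hE hm hbias hq2 hnorm h1 (by omega)⟩
  by_contra hW
  exact not_dFma_of_fmaMidPairTest hE hm hq2 h1 hb hreg hT (not_le.mp hW) hD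

/-- The hypotheses of `dFma_middle_iff` as ONE Boolean test on a pair of records, and its
verdict. [this packet] -/
def dFmaMiddleHyp (φ ψ : Format) : Bool :=
  embedsTest φ ψ && decide (2 * φ.manBits + 1 ≤ ψ.manBits) && decide (φ.bias ≤ ψ.bias)
    && decide (ψ.qexp ≤ 2 * φ.qexp) && decide (ψ.qexp + ψ.manBits + 1 ≤ φ.qexp)
    && decide (1 ≤ φ.manBits) && decide (1 ≤ φ.bias)
    && decide (φ.bias + 2 * φ.manBits ≤ ψ.manBits + 1)
    && fmaMidPairTest φ.manBits (ψ.manBits - φ.manBits)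

/-- `dFma_middle_iff` from the Boolean hypothesis test. [this packet] -/
theorem dFma_middle_of_hyp {φ ψ : Format} (h : dFmaMiddleHyp φ ψ = true) :
    DFma φ ψ ↔ φ.maxScaled ≤ 2 ^ (ψ.manBits + 2 - φ.manBits - φ.bias) := by
  simp only [dFmaMiddleHyp, Bool.and_eq_true, decide_eq_true_eq] at h
  obtain ⟨⟨⟨⟨⟨⟨⟨⟨hE, hm⟩, hbias⟩, hq2⟩, hnorm⟩, h1⟩, hb⟩, hreg⟩, hT⟩ := h
  exact dFma_middle_iff hE hm hbias hq2 hnorm h1 hb hreg hT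

/-! ## §4 The table of the test -/

/-- `fmaMidPairTest m n` holds on EVERY middle column `m + 1 ≤ n ≤ 2m` for `1 ≤ m ≤ 11`
(implementation A: `m ≤ 16` except `(12, 23)` and `(16, 31)`). [this packet] -/
theorem fmaMidPair_table :
    ∀ m < 12, ∀ n < 2 * m + 1, 1 ≤ m → m + 1 ≤ n → fmaMidPairTest m n = true := by
  decide +kernel

/-- THE FIRST EXCEPTION: a `13`-digit source through a `36`-digit register — `2^23 - 1 = 47·178481`
and no `K·2^23 + 1` with `K < 8` is a product of two `13`-digit numbers, so the first midpoint of
window B is NOT a slip point (implementation A: a slip just below the second midpoint,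
`6563·7669 = 6·2^23 - 1`). [this packet] -/
theorem fmaMidPair_12_23 : fmaMidPairTest 12 23 = false := by
  decide +kernel

/-- On EVEN columns the test always holds: `2^(2h) - 1 = (2^h - 1)(2^h + 1)` (THEOREM N-fma-B's
tie pair), `1 ≤ h ≤ m`. [this packet] -/
theorem fmaMidPairTest_even {m h : ℕ} (h0 : 1 ≤ h) (hh : h ≤ m) :
    fmaMidPairTest m (2 * h) = true := by
  unfold fmaMidPairTest
  rw [Bool.or_eq_true]
  left
  have h2 : 2 ^ h ≤ 2 ^ m := Nat.pow_le_pow_right (by norm_num) hh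
  have h3 : 2 ^ (m + 1) = 2 * 2 ^ m := by rw [pow_succ]; ring
  have h5 : 2 ≤ 2 ^ h :=
    calc 2 = 2 ^ 1 := (pow_one 2).symm
      _ ≤ 2 ^ h := Nat.pow_le_pow_right (by norm_num) h0
  have hlt : 2 ^ h + 1 < 2 ^ (m + 1) := by rw [h3]; omega
  have hlt' : 2 ^ h - 1 < 2 ^ (m + 1) := lt_of_le_of_lt (Nat.sub_le _ _) (by omega)
  have hpos : 0 < 2 ^ h - 1 := by omega
  have e : 2 ^ (2 * h) - 1 = (2 ^ h - 1) * (2 ^ h + 1) := by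
    have h4 := Nat.one_le_two_pow (n := h)
    zify [h4, Nat.one_le_two_pow (n := 2 * h)]
    rw [pow_mul']; ring
  rw [e]
  exact twoSigTest_mul_eq_true hpos hlt' hlt

/-! ## §5 The named records -/

/-- ON THE NAMED `13 × 13` MATRIX (and the binary64 column) the hypotheses of `dFma_middle_iff`
hold on exactly these `5` cells, and there the threshold agrees with the matrix `dFmaPairs`
(e2m1 → binary8p5 holds — `P_ψ = 5 = 3 P_φ - 1`, `9 = 3·3`, `M = 12 ≤ W = 16` quanta; e2m1 →
e4m3 / binary8p4 / binary8p4f and e2m3 → bfloat16 fail).  Implementation A tabulates the same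
cells. [this packet] -/
theorem dFmaMiddle_named : ∀ X ∈ namedFormats, ∀ Y ∈ namedFormats ++ [Binary64],
    (dFmaMiddleHyp X Y = true ↔
      (X, Y) ∈ [(E2M1, E4M3), (E2M1, Binary8p4), (E2M1, Binary8p5), (E2M1, Binary8p4F),
        (E2M3, BFloat16)]) ∧
    ((X, Y) ∈ [(E2M1, E4M3), (E2M1, Binary8p4), (E2M1, Binary8p5), (E2M1, Binary8p4F),
        (E2M3, BFloat16)] →
      (decide (X.maxScaled ≤ 2 ^ (Y.manBits + 2 - X.manBits - X.bias)) = true ↔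
        (X, Y) ∈ dFmaPairs)) := by
  decide +kernel

/-- THE `5` NAMED MIDDLE CELLS DECIDED BY THE THRESHOLD ALONE: `DFma X Y ↔ M_X ≤ 2^(m_Y+2-m_X-bias)`,
true exactly for e2m1 → binary8p5. [this packet] -/
theorem dFmaMiddle_cells : ∀ p ∈ [(E2M1, E4M3), (E2M1, Binary8p4), (E2M1, Binary8p5),
      (E2M1, Binary8p4F), (E2M3, BFloat16)],
    (DFma p.1 p.2 ↔ p.1.maxScaled ≤ 2 ^ (p.2.manBits + 2 - p.1.manBits - p.1.bias)) ∧
      (p.1.maxScaled ≤ 2 ^ (p.2.manBits + 2 - p.1.manBits - p.1.bias) ↔ p = (E2M1, Binary8p5)) := by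
  have H : ∀ p ∈ [(E2M1, E4M3), (E2M1, Binary8p4), (E2M1, Binary8p5),
      (E2M1, Binary8p4F), (E2M3, BFloat16)],
      dFmaMiddleHyp p.1 p.2 = true ∧
      (p.1.maxScaled ≤ 2 ^ (p.2.manBits + 2 - p.1.manBits - p.1.bias) ↔ p = (E2M1, Binary8p5)) := by
    decide +kernel
  intro p hp
  obtain ⟨h, hv⟩ := H p hp
  exact ⟨dFma_middle_of_hyp h, hv⟩

end Summit.Ventures.CertifiedArithmetic
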